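import Summits.BirchSwinnertonDyer.BirchSwinnertonDyer.Theorems.ManinLocalTwoThreeShimuraQuotientConjugation
import Summits.BirchSwinnertonDyer.BirchSwinnertonDyer.Theorems.ManinLocalTwoThreeManinOfStevensConjectures
import HarnessLib

/-!
# E-an-152b `ShimuraIndexNeFourAtFour` reduces to RECTANGULAR Néron lattices; the Stevens road to C2 with the rectangular law

Summit `BirchSwinnertonDyer`, route `ManinLocalTwoThree` (cell bsd-f2-manin), crux C2 `ManinOddAtFour` (stmt-BirchSwinnertonDyer-22967); lead p1 gen 14.
By `…ShimuraQuotientConjugation.not_periodLatticeGamma1_eq_two_mul_of_re_notMem` the index-`4` configuration `Λ₁(f) = 2Λ₀(f)` forces the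
Néron lattice `Λ_{E₀}` to be rectangular (`re z ∈ Λ_{E₀}` for all `z ∈ Λ_{E₀}`; i.e. `E₀(ℝ)` has two components, `E₀[2] ⊂ E₀(ℝ)`).  Hence:

* `shimuraIndexNeFourAtFour_of_rectangular` — **E-an-152b ⟸ its RECTANGULAR sub-law** (inline hypothesis: no lattice-optimal `X₀(N)`-datum at
  `4 ∣ N` with rectangular `Λ_{E₀}` has `Λ₁(f) = 2Λ₀(f)`); the non-rectangular half is a theorem;
* `maninOddAtFour_of_stevens_of_rectangular` — **C2 ⟸ F-need ∧ Stevens I ∧ Stevens II ∧ the rectangular sub-law** (by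
  `maninOddAtFour_of_stevensConjectures`).

For -an's census: only optimal curves with rectangular period lattice (positive discriminant; arithmetic shadow: full rational `2`-torsion,
since index `4` means `E₁ = E₀` with `ker [2]` constant) can violate E-an-152b.  HONEST FRAMING: CONDITIONAL edges; the rectangular
sub-law, Stevens I/II and F-need are OPEN / statement-only; Manin's conjecture, C2 and BSD are NOT proved.  No definitions, no named facts,
no sorry. [cite: Stevens1989, Conjectures I–II, §2] [cite: LingOesterle1991, Thm. 6]
-/

set_option autoImplicit false
-- the summit-side namespace `Summit.BirchSwinnertonDyer.BirchSwinnertonDyer.…` is the tree's (summit = sub-problem)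
set_option linter.dupNamespace false

noncomputable section

open scoped Classical
open WeierstrassCurve Literature.NumberTheory.EllipticCurves Literature.NumberTheory.EllipticCurves.ModularForms
open CongruenceSubgroup
open Summit.BirchSwinnertonDyer.Rank1Residual.ManinAdditive.ShimuraKernel
open Summit.BirchSwinnertonDyer.Rank1Residual.ManinAdditive.KatoCurve
open Summit.BirchSwinnertonDyer.Rank1Residual.ManinConstant

namespace Summit.BirchSwinnertonDyer.BirchSwinnertonDyer.Theorems.ManinLocalTwoThree

/-- **E-an-152b ⟸ its rectangular sub-law.**  If no lattice-optimal `X₀(N)`-datum at `4 ∣ N` whose Néron lattice is RECTANGULAR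
(`re z ∈ Λ_{E₀}` for every `z ∈ Λ_{E₀}`) is in the index-`4` configuration, then E-an-152b `ShimuraIndexNeFourAtFour` holds: the
non-rectangular case is `not_periodLatticeGamma1_eq_two_mul_of_re_notMem`.  CONDITIONAL edge. [cite: Stevens1989, §2] -/
theorem shimuraIndexNeFourAtFour_of_rectangular
    (hrect : ∀ (W₀ : WeierstrassCurve ℚ) [W₀.IsElliptic] [W₀.IsGloballyMinimal] {N : ℕ} [NeZero N]
      (D₀ : ModularParametrizationData W₀ N),
      (∀ z ∈ D₀.L.lattice, ∃ w ∈ periodLattice D₀.f, z = D₀.c * w) → 2 ^ 2 ∣ N →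
      (∀ z ∈ D₀.L.lattice, (z.re : ℂ) ∈ D₀.L.lattice) →
      ¬ (∀ z : ℂ, z ∈ periodLatticeGamma1 D₀.f ↔ ∃ w ∈ periodLattice D₀.f, z = 2 * w)) :
    ShimuraIndexNeFourAtFour := by
  intro W₀ _ _ N _ D₀ h₀ h4 hidx
  by_cases hr : ∀ z ∈ D₀.L.lattice, (z.re : ℂ) ∈ D₀.L.lattice
  · exact hrect W₀ D₀ h₀ h4 hr hidx
  · push Not at hr
    obtain ⟨z, hz, hre⟩ := hr
    exact not_periodLatticeGamma1_eq_two_mul_of_re_notMem D₀ h₀ hz hre hidx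

/-- **C2 `ManinOddAtFour` ⟸ F-need ∧ Stevens I ∧ Stevens II ∧ the RECTANGULAR sub-law of E-an-152b** (`maninOddAtFour_of_stevensConjectures`
with E-an-152b supplied by `shimuraIndexNeFourAtFour_of_rectangular`).  CONDITIONAL; all four inputs OPEN / statement-only; BSD is not proved
by this; C2 OPEN. [cite: Stevens1989, Conjectures I–III, Thm. 2.3] -/
theorem maninOddAtFour_of_stevens_of_rectangular (hex : exists_optimal_gamma1ParametrizationData)
    (hSt1 : StevensConstantOne)
    (hSt2 : ∀ (W₁ : WeierstrassCurve ℚ) [W₁.IsElliptic] [W₁.IsGloballyMinimal] {N : ℕ} [NeZero N]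
      (D₁ : Gamma1ParametrizationData W₁ N), D₁.IsOptimal → 2 ^ 2 ∣ N → IsMaxCovolumeInClass W₁)
    (hrect : ∀ (W₀ : WeierstrassCurve ℚ) [W₀.IsElliptic] [W₀.IsGloballyMinimal] {N : ℕ} [NeZero N]
      (D₀ : ModularParametrizationData W₀ N),
      (∀ z ∈ D₀.L.lattice, ∃ w ∈ periodLattice D₀.f, z = D₀.c * w) → 2 ^ 2 ∣ N →
      (∀ z ∈ D₀.L.lattice, (z.re : ℂ) ∈ D₀.L.lattice) →
      ¬ (∀ z : ℂ, z ∈ periodLatticeGamma1 D₀.f ↔ ∃ w ∈ periodLattice D₀.f, z = 2 * w)) :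
    Summit.BirchSwinnertonDyer.BirchSwinnertonDyer.Theses.ManinLocalTwoThree.ManinOddAtFour :=
  maninOddAtFour_of_stevensConjectures hex hSt1 hSt2 (shimuraIndexNeFourAtFour_of_rectangular hrect)

/-- **Per-datum transfer at `4 ∣ N` under Stevens II, rectangular residue isolated**: for the optimal pair of a class, Stevens II for the
Stevens curve gives `|c₀| = |c₁|` UNLESS `Λ_{E₀}` is rectangular and `Λ₁(f) = 2Λ₀(f)`.  CONDITIONAL on Stevens II.
[cite: Stevens1989, Conjecture II, Thm. 2.3] -/
theorem natAbs_maninConstant₀_eq_or_rectangular_index_four_of_maxCovolume {W₁ W₀ : WeierstrassCurve ℚ} [W₁.IsElliptic]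
    [W₁.IsGloballyMinimal] [W₀.IsElliptic] [W₀.IsGloballyMinimal] {N : ℕ} [NeZero N]
    (D₁ : Gamma1ParametrizationData W₁ N) (D₀ : ModularParametrizationData W₀ N) (hiso : IsIsogenous W₁ W₀)
    (h₁ : D₁.IsOptimal) (h₀ : ∀ z ∈ D₀.L.lattice, ∃ w ∈ periodLattice D₀.f, z = D₀.c * w) (h4 : 2 ^ 2 ∣ N)
    (hmax : IsMaxCovolumeInClass W₁) :
    D₀.maninConstant.natAbs = D₁.maninConstant.natAbs ∨
      ((∀ z ∈ D₀.L.lattice, (z.re : ℂ) ∈ D₀.L.lattice) ∧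
        (∀ z : ℂ, z ∈ periodLatticeGamma1 D₀.f ↔ ∃ w ∈ periodLattice D₀.f, z = 2 * w)) := by
  by_cases hidx : ∀ z : ℂ, z ∈ periodLatticeGamma1 D₀.f ↔ ∃ w ∈ periodLattice D₀.f, z = 2 * w
  · refine Or.inr ⟨fun z hz ↦ ?_, hidx⟩
    exact (re_mem_and_im_mul_I_mem_of_periodLatticeGamma1_eq_two_mul D₀ h₀ hidx hz).1
  · exact Or.inl (natAbs_maninConstant₀_eq_of_maxCovolume_of_index_ne_four D₁ D₀ hiso h₁ h₀ h4 hmax hidx)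

end Summit.BirchSwinnertonDyer.BirchSwinnertonDyer.Theorems.ManinLocalTwoThree

end
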